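import Summits.HodgeConjecture.CorCM.PrimeDegreeSlotPairsHodge
import Summits.HodgeConjecture.CorCM.SimpleCMProductsDimLeThreeHodge
import HarnessLib

/-!
# Slots of large prime half-degree SPLIT OFF any family: `Hg(∏_a A_a × ∏_b B_b) = ∏_a Hg(A_a) × Hg(∏_b B_b)` for simple CM
# abelian varieties `A_a` of pairwise distinct prime dimensions exceeding the dimensions of the `B_b` — unless an
# imaginary quadratic field is shared; the census for simple factors of dimension `≤ 3` OR prime `≥ 5`

COR-CM (cell `pub-hodgecm2`, binder seat `b16` gen 46, count-neutral claim PRIME-SLOT, file F5; theorems only, no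
definition, no named fact, no `sorry`).  NEW as stated, hence under `Summits/`.  The `n`-slot, block form of
`CorCM/PrimeDegreeSlotPairsHodge`: by `pairwise_of_prime_of_not_exists_quadratic` a slot `a` with `[K_a : ℚ] = 2p_a`
(`p_a` an odd prime) has no common constituent with ANY slot of degree `< 2p_a` not receiving an imaginary quadratic
subfield of `K_a`; by this seat's gen-43 fibre theorem (`isNondegenerateFamily_of_fibers`, on p2's
`CMTypeRankPartitionSlots`: nondegeneracy is decided block by block once no two slots of different blocks share a
constituent) such slots are SINGLETON BLOCKS:

* §1 **`isNondegenerateFamily_iff_of_primeSlots`** — a family whose slots `a ∈ Q` have degrees `2p_a`, `p_a` PAIRWISE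
  DISTINCT ODD PRIMES, each LARGER than half the degree of every slot outside `Q`, and such that no imaginary quadratic
  subfield of a `K_a` (`a ∈ Q`) embeds in another field of the family: `(Φ_i)_i` is nondegenerate ⟺ every `Φ_a` (`a ∈ Q`)
  is nondegenerate ∧ the sub-family OUTSIDE `Q` is nondegenerate.  NOTHING is asked of the slots outside `Q` among
  themselves (they may share fields, closures, constituents).  The converse obstruction is seat b23's: a shared imaginary
  quadratic field makes every family degenerate.
* §2 on abelian varieties — SIMPLE, pairwise non-isogenous CM realisations `A_i`; `Q` = the slots of PRIME dimension
  `≥ 5`, pairwise distinct, all other slots of dimension `≤ 3`: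
  **`isNondegenerateFamily_iff_of_primeFactors_dim_le_three`** — `Hg(∏ A_i) = ∏ Hg(A_i)` ⟺ (P) no imaginary quadratic
  subfield of the CM field of a prime-dimensional factor embeds in another factor's field ∧ (i)–(iii) of this seat's gen-43
  census `isNondegenerateFamily_simpleFamily_dim_le_three_iff` ON THE SMALL FACTORS (no imaginary quadratic field shared,
  no sextic field more than three times, no Galois closure carrying more than two quartic fields);
  **`hodgeConjectureFor_prod_of_primeFactors_dim_le_three`** — then the Hodge conjecture and `B• = D•` on EVERY
  `∏_i A_i^{k_i}`, UNCONDITIONALLY; `exists_exceptional_prod_of_shared_quadratic_primeFactor` — a prime factor sharing an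
  imaginary quadratic field with another factor forces an exceptional Hodge class on some product.
  New dimension patterns decided: `5+3`, `5+2+…`, `5+3+2+1+⋯`, `7+3+3+…`, `5+7+(≤3)s`, `11+…`, … .

HONEST FRAMING: the Hodge conjecture for NAMED classes of CM abelian varieties; `HC_CM` is neither used nor asserted.

## References

* [Gordon1999HodgeAVSurvey] B. B. Gordon, *A survey of the Hodge conjecture for abelian varieties*, §3 Theorem (Imai,
  Murty), 6.3 Remark (Yanai), 7.4–7.7, 9.4, 10.10.
* [MoonenZarhin1999LowDim] B. Moonen, Yu. Zarhin, *Hodge classes on abelian varieties of low dimension*, Math. Ann. 315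
  (1999), Thm. (0.2), §3 (3.1).
-/

noncomputable section

open CategoryTheory CategoryTheory.Limits NumberField NumberField.ComplexEmbedding Module IntermediateField
open scoped BigOperators

namespace Summit.HodgeConjecture.CorCM

open Literature.NumberTheory.ComplexMultiplication
open Literature.AlgebraicGeometry.Motives (AbelianVariety CMType)
open Literature.AlgebraicGeometry.HodgeTheory
open Literature.AlgebraicGeometry.ComplexMultiplication (IsCMTypeRealisation isSimple_iff_isPrimitive)
open Literature.AlgebraicGeometry.VanGeemen1994 (hodgeClassSpan)
open Literature.AlgebraicGeometry.Pohlmann1968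
open Literature.Barriers.HodgeConjecture (divisorClassesSpan)

/-! ## §1 CM fields: slots of large, pairwise distinct, odd prime half-degree are singleton blocks -/

section Fields

variable {I : Type} {K : I → Type} [∀ i, Field (K i)] [∀ i, NumberField (K i)] [∀ i, IsCMField (K i)] [Fintype I]
  [DecidableEq I]

omit [Fintype I] [DecidableEq I] in
/-- **The slot criterion across the partition "each big prime slot alone, everything else together".**  With `q` the
big slots (degrees `2p_a`, `p_a` pairwise distinct odd primes exceeding half the degree of every other slot) and no
imaginary quadratic subfield of a big `K_a` embedding elsewhere: any two slots in different blocks of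
`κ = (a ↦ a on q, · ↦ ⋆ off q)` have no common constituent. [cite: Gordon1999HodgeAVSurvey, §3 Theorem (proof) and 6.3 Remark] -/
theorem pairwise_across_primeSlots (q : I → Prop) [DecidablePred q] (p : I → ℕ)
    (hbig : ∀ a, q a → (p a).Prime ∧ p a ≠ 2 ∧ finrank ℚ (K a) = 2 * p a)
    (hlt : ∀ a b, q a → ¬ q b → finrank ℚ (K b) < 2 * p a)
    (hdist : ∀ a a', q a → q a' → a ≠ a' → p a ≠ p a')
    (hno : ∀ a j, q a → a ≠ j →
      ¬ ∃ F : IntermediateField ℚ (K a), finrank ℚ F = 2 ∧ IsTotallyComplex F ∧ Nonempty (F →+* K j))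
    (Φ : ∀ i, CMType (K i)) :
    ∀ i j, (if q i then some i else none : Option I) ≠ (if q j then some j else none) →
      ∀ P : Submodule ℚ ((K i →+* ℂ) → ℚ), P ≤ antiSpan (ℂ ≃+* ℂ) (Φ i).1 →
      (∀ g : ℂ ≃+* ℂ, ∀ f ∈ P, (fun x => f (g • x)) ∈ P) →
      ∀ T : ((K i →+* ℂ) → ℚ) →ₗ[ℚ] ((K j →+* ℂ) → ℚ),
        (∀ g : ℂ ≃+* ℂ, ∀ f ∈ P, T (fun x => f (g • x)) = fun y => T f (g • y)) →
        (∀ f ∈ P, T f ∈ antiSpan (ℂ ≃+* ℂ) (Φ j).1) → (∀ f ∈ P, T f = 0 → f = 0) → P = ⊥ := by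
  intro i j hij
  by_cases hi : q i <;> by_cases hj : q j
  · -- two big slots: distinct primes, the larger one is the prime slot
    have hne : i ≠ j := by rintro rfl; exact hij rfl
    obtain ⟨hpi, hi2, hKi⟩ := hbig i hi
    obtain ⟨hpj, hj2, hKj⟩ := hbig j hj
    rcases lt_or_gt_of_ne (hdist i j hi hj hne) with h | h
    · exact (pairwise_of_prime_of_not_exists_quadratic Φ hpj hj2 hKj (by rw [hKi]; omega) (hno j i hj hne.symm)).2
    · exact (pairwise_of_prime_of_not_exists_quadratic Φ hpi hi2 hKi (by rw [hKj]; omega) (hno i j hi hne)).1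
  · obtain ⟨hpi, hi2, hKi⟩ := hbig i hi
    have hne : i ≠ j := by rintro rfl; exact hj hi
    exact (pairwise_of_prime_of_not_exists_quadratic Φ hpi hi2 hKi (hlt i j hi hj) (hno i j hi hne)).1
  · obtain ⟨hpj, hj2, hKj⟩ := hbig j hj
    have hne : j ≠ i := by rintro rfl; exact hi hj
    exact (pairwise_of_prime_of_not_exists_quadratic Φ hpj hj2 hKj (hlt j i hj hi) (hno j i hj hne)).2
  · exact absurd (by rw [if_neg hi, if_neg hj]) hij

/-- **Big prime slots split off.**  Let the slots `a` with `q a` have degrees `[K_a : ℚ] = 2p_a` with the `p_a` PAIRWISE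
DISTINCT ODD PRIMES, each exceeding half the degree of every slot off `q`, and suppose no imaginary quadratic subfield
of a `K_a` (`q a`) embeds in any other `K_j`.  Then, for ANY types, `(Φ_i)_i` is nondegenerate iff every big `Φ_a` is
nondegenerate and the sub-family off `q` is nondegenerate — `Hg(∏_i A_i) = ∏_{q a} Hg(A_a) × Hg(∏_{¬ q b} A_b)`; nothing
is asked of the slots off `q` among themselves. [cite: MoonenZarhin1999LowDim, §3 (3.1)]
[cite: Gordon1999HodgeAVSurvey, §3 Theorem, 6.3 Remark and 7.5–7.7] -/
theorem isNondegenerateFamily_iff_of_primeSlots [Nonempty I] (q : I → Prop) [DecidablePred q] (p : I → ℕ)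
    (hbig : ∀ a, q a → (p a).Prime ∧ p a ≠ 2 ∧ finrank ℚ (K a) = 2 * p a)
    (hlt : ∀ a b, q a → ¬ q b → finrank ℚ (K b) < 2 * p a)
    (hdist : ∀ a a', q a → q a' → a ≠ a' → p a ≠ p a')
    (hno : ∀ a j, q a → a ≠ j →
      ¬ ∃ F : IntermediateField ℚ (K a), finrank ℚ F = 2 ∧ IsTotallyComplex F ∧ Nonempty (F →+* K j))
    (Φ : ∀ i, CMType (K i)) :
    CMAlgebra.IsNondegenerateFamily Φ ↔ (∀ a, q a → IsNondegenerate (Φ a)) ∧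
      ((∃ b, ¬ q b) → CMAlgebra.IsNondegenerateFamily (K := fun b : {b // ¬ q b} => K b.1) fun b => Φ b.1) := by
  classical
  constructor
  · intro hnd
    exact ⟨fun a _ => hnd.isNondegenerate a, fun hb => isNondegenerateFamily_subtype hnd (fun b => ¬ q b) hb⟩
  · rintro ⟨hbignd, hsmall⟩
    refine isNondegenerateFamily_of_fibers Φ (fun i => if q i then some i else none)
      (pairwise_across_primeSlots q p hbig hlt hdist hno Φ) fun c hc => ?_
    obtain ⟨i₀, hi₀⟩ := hc
    by_cases hq : q i₀
    · -- a singleton block `{i₀}`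
      rw [if_pos hq] at hi₀
      subst hi₀
      have hmem : ∀ i, (if q i then some i else none : Option I) = some i₀ ↔ i = i₀ := by
        intro i
        by_cases h : q i
        · rw [if_pos h, Option.some_inj]
        · rw [if_neg h]; exact ⟨fun h' => (Option.some_ne_none i₀ h'.symm).elim, fun h' => absurd (h' ▸ hq) h⟩
      haveI : Nonempty {i // (if q i then some i else none : Option I) = some i₀} := ⟨⟨i₀, (hmem i₀).2 rfl⟩⟩
      haveI : Subsingleton {i // (if q i then some i else none : Option I) = some i₀} :=
        ⟨fun x y => Subtype.ext (((hmem x.1).1 x.2).trans ((hmem y.1).1 y.2).symm)⟩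
      exact isNondegenerateFamily_of_subsingleton (K := fun i : {i // (if q i then some i else none) = some i₀} => K i.1)
        (fun i => Φ i.1) fun i => by
          obtain ⟨i, hi⟩ := i
          have hi' : i = i₀ := (hmem i).1 hi
          subst hi'
          exact hbignd i hq
    · -- the block off `q`
      rw [if_neg hq] at hi₀
      subst hi₀
      have hmem : ∀ i, (if q i then some i else none : Option I) = none ↔ ¬ q i := by
        intro i
        by_cases h : q i
        · rw [if_pos h]; exact ⟨fun h' => (Option.some_ne_none i h').elim, fun h' => absurd h h'⟩
        · rw [if_neg h]; exact ⟨fun _ => h, fun _ => rfl⟩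
      let e : {b // ¬ q b} ≃ {i // (if q i then some i else none : Option I) = none} :=
        Equiv.subtypeEquivRight fun i => (hmem i).symm
      exact (isNondegenerateFamily_iff_of_equiv (K := fun i : {i // (if q i then some i else none) = none} => K i.1)
        (fun i => Φ i.1) e).1 (hsmall ⟨i₀, hq⟩)

end Fields

/-! ## §2 Abelian varieties: simple factors of dimension `≤ 3` or of pairwise distinct prime dimension `≥ 5` -/

section Geometry

variable {I : Type} {K : I → Type} [∀ i, Field (K i)] [∀ i, NumberField (K i)] [∀ i, IsCMField (K i)] [Fintype I]
  [DecidableEq I] [Nonempty I] {Φ : ∀ i, CMType (K i)}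
variable {A : I → AbelianVariety ℂ} {ι : ∀ i, 𝓞 (K i) →+* End (A i)}
  {θ : ∀ i, K i →+* Module.End ℂ (complexBetti (A i).X 1)}

/-- **Prime-dimensional simple factors split off small ones.**  SIMPLE, pairwise non-isogenous CM realisations `A_i`, each
of dimension `≤ 3` or of PRIME dimension `≥ 5`, the prime dimensions pairwise distinct, and (P) no imaginary quadratic
subfield of the CM field of a prime-dimensional factor embedding in another factor's field: `(Φ_i)_i` is nondegenerate
iff the sub-family of SMALL factors is. [cite: MoonenZarhin1999LowDim, §3 (3.1)] [cite: Gordon1999HodgeAVSurvey, 6.3 Remark and 7.5–7.7] -/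
theorem isNondegenerateFamily_iff_small_of_primeFactors (hA : ∀ i, IsCMTypeRealisation (Φ i) (A i) (ι i) (θ i))
    (hS : ∀ i, (A i).IsSimple) (hdim : ∀ i, (A i).dim ≤ 3 ∨ (((A i).dim).Prime ∧ 5 ≤ (A i).dim))
    (hdist : ∀ a a', 5 ≤ (A a).dim → 5 ≤ (A a').dim → a ≠ a' → (A a).dim ≠ (A a').dim)
    (hno : ∀ a j, 5 ≤ (A a).dim → a ≠ j →
      ¬ ∃ F : IntermediateField ℚ (K a), finrank ℚ F = 2 ∧ IsTotallyComplex F ∧ Nonempty (F →+* K j)) :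
    CMAlgebra.IsNondegenerateFamily Φ ↔
      ((∃ b, (A b).dim ≤ 3) →
        CMAlgebra.IsNondegenerateFamily (K := fun b : {b // ¬ 5 ≤ (A b).dim} => K b.1) fun b => Φ b.1) := by
  have hK : ∀ i, finrank ℚ (K i) = 2 * (A i).dim := fun i => finrank_eq_two_mul_dim_of_isCMTypeRealisation (hA i)
  have hbig : ∀ a, 5 ≤ (A a).dim → ((A a).dim).Prime ∧ (A a).dim ≠ 2 ∧ finrank ℚ (K a) = 2 * (A a).dim := fun a ha => by
    rcases hdim a with h | h
    · omega
    · exact ⟨h.1, by omega, hK a⟩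
  have hlt : ∀ a b, 5 ≤ (A a).dim → ¬ 5 ≤ (A b).dim → finrank ℚ (K b) < 2 * (A a).dim := fun a b ha hb => by
    rcases hdim b with h | h
    · rw [hK b]; omega
    · exact absurd h.2 hb
  have hnd : ∀ a, 5 ≤ (A a).dim → IsNondegenerate (Φ a) := fun a ha => by
    obtain ⟨φ₀⟩ : Nonempty (K a →+* ℂ) := inferInstance
    exact isNondegenerate_of_isPrimitive_of_prime (hbig a ha).1 (hK a) φ₀ ((isSimple_iff_isPrimitive (hA a) φ₀).1 (hS a))
  rw [isNondegenerateFamily_iff_of_primeSlots (fun a => 5 ≤ (A a).dim) (fun a => (A a).dim) hbig hlt hdist hno Φ]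
  have hex : (∃ b, (A b).dim ≤ 3) ↔ ∃ b, ¬ 5 ≤ (A b).dim :=
    ⟨fun ⟨b, hb⟩ => ⟨b, by omega⟩, fun ⟨b, hb⟩ => ⟨b, by rcases hdim b with h | h <;> omega⟩⟩
  rw [hex]
  exact ⟨fun H => H.2, fun H => ⟨hnd, H⟩⟩

open scoped Classical in
/-- **The census for simple factors of dimension `≤ 3` or of pairwise distinct prime dimension `≥ 5`.**  SIMPLE, pairwise
non-isogenous CM abelian varieties `A_i` (realisations of `(K_i; Φ_i)` on `H¹`), each of dimension `≤ 3` or of prime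
dimension `≥ 5`, the primes pairwise distinct: `Hg(∏ A_i) = ∏ Hg(A_i)` — equivalently `B• = D•` on every `∏_i A_i^{k_i}` —
iff (P) no imaginary quadratic subfield of the CM field of a PRIME-dimensional factor embeds in another factor's field,
and, among the factors of dimension `≤ 3`: (i) no imaginary quadratic subfield of one field embeds in another, (ii) no
sextic field occurs more than three times up to isomorphism, (iii) no Galois closure carries more than two of the quartic
fields (this seat's gen-43 census). [cite: MoonenZarhin1999LowDim, Thm. (0.2) and §3] [cite: Gordon1999HodgeAVSurvey, 6.3 Remark, 7.4–7.7 and 9.4] -/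
theorem isNondegenerateFamily_iff_of_primeFactors_dim_le_three (hA : ∀ i, IsCMTypeRealisation (Φ i) (A i) (ι i) (θ i))
    (hS : ∀ i, (A i).IsSimple) (hniso : ∀ i j, i ≠ j → ¬ AbelianVariety.IsIsogenous (A i) (A j))
    (hdim : ∀ i, (A i).dim ≤ 3 ∨ (((A i).dim).Prime ∧ 5 ≤ (A i).dim))
    (hdist : ∀ a a', 5 ≤ (A a).dim → 5 ≤ (A a').dim → a ≠ a' → (A a).dim ≠ (A a').dim) :
    CMAlgebra.IsNondegenerateFamily Φ ↔
      (∀ a j, 5 ≤ (A a).dim → a ≠ j →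
        ¬ ∃ F : IntermediateField ℚ (K a), finrank ℚ F = 2 ∧ IsTotallyComplex F ∧ Nonempty (F →+* K j)) ∧
      (∀ i j : {b // ¬ 5 ≤ (A b).dim}, i ≠ j →
        ¬ ∃ F : IntermediateField ℚ (K i.1), finrank ℚ F = 2 ∧ IsTotallyComplex F ∧ Nonempty (F →+* K j.1)) ∧
      (∀ i : {b // ¬ 5 ≤ (A b).dim}, finrank ℚ (K i.1) = 6 →
        (Finset.univ.filter fun j : {b // ¬ 5 ≤ (A b).dim} => Nonempty (K j.1 ≃+* K i.1)).card ≤ 3) ∧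
      (∀ i : {b // ¬ 5 ≤ (A b).dim}, finrank ℚ (K i.1) = 4 →
        (Finset.univ.filter fun j : {b // ¬ 5 ≤ (A b).dim} =>
          normalClosure ℚ (K j.1) ℂ = normalClosure ℚ (K i.1) ℂ).card ≤ 2) := by
  classical
  constructor
  · intro hnd
    have hP : ∀ a j, 5 ≤ (A a).dim → a ≠ j →
        ¬ ∃ F : IntermediateField ℚ (K a), finrank ℚ F = 2 ∧ IsTotallyComplex F ∧ Nonempty (F →+* K j) := by
      rintro a j - haj ⟨F, hF2, hFtc, ⟨f⟩⟩
      haveI := hFtc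
      exact not_isNondegenerateFamily_of_shared_imaginary_quadratic (k := ↥F) hF2 haj (algebraMap (↥F) (K a)) f Φ hnd
    refine ⟨hP, ?_⟩
    by_cases hb : ∃ b, (A b).dim ≤ 3
    · have hsmall := (isNondegenerateFamily_iff_small_of_primeFactors hA hS hdim hdist hP).1 hnd hb
      obtain ⟨b, hb⟩ := hb
      haveI : Nonempty {b // ¬ 5 ≤ (A b).dim} := ⟨⟨b, by omega⟩⟩
      exact (isNondegenerateFamily_simpleFamily_dim_le_three_iff (K := fun b : {b // ¬ 5 ≤ (A b).dim} => K b.1)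
        (fun b => hA b.1) (fun b => hS b.1) (fun i j hij => hniso i.1 j.1 fun h => hij (Subtype.ext h))
        (fun b => by rcases hdim b.1 with h | h <;> [exact h; exact absurd h.2 b.2])).1 hsmall
    · have hempty : IsEmpty {b // ¬ 5 ≤ (A b).dim} :=
        ⟨fun b => hb ⟨b.1, by rcases hdim b.1 with h | h <;> [exact h; exact absurd h.2 b.2]⟩⟩
      exact ⟨fun i => hempty.elim i, fun i => hempty.elim i, fun i => hempty.elim i⟩
  · rintro ⟨hP, h1, h2, h3⟩
    refine (isNondegenerateFamily_iff_small_of_primeFactors hA hS hdim hdist hP).2 fun hb => ?_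
    obtain ⟨b, hb⟩ := hb
    haveI : Nonempty {b // ¬ 5 ≤ (A b).dim} := ⟨⟨b, by omega⟩⟩
    exact (isNondegenerateFamily_simpleFamily_dim_le_three_iff (K := fun b : {b // ¬ 5 ≤ (A b).dim} => K b.1)
      (fun b => hA b.1) (fun b => hS b.1) (fun i j hij => hniso i.1 j.1 fun h => hij (Subtype.ext h))
      (fun b => by rcases hdim b.1 with h | h <;> [exact h; exact absurd h.2 b.2])).2 ⟨h1, h2, h3⟩

open scoped Classical in
/-- **The Hodge conjecture on every product of powers** of simple, pairwise non-isogenous CM abelian varieties of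
dimension `≤ 3` or of pairwise distinct prime dimension `≥ 5`, under (P) and the gen-43 conditions (i)–(iii) on the small
factors — with `B• = D•` there, UNCONDITIONALLY. [cite: Gordon1999HodgeAVSurvey, §3 Theorem, 6.3 Remark and 10.10] -/
theorem hodgeConjectureFor_prod_of_primeFactors_dim_le_three (hA : ∀ i, IsCMTypeRealisation (Φ i) (A i) (ι i) (θ i))
    (hS : ∀ i, (A i).IsSimple) (hniso : ∀ i j, i ≠ j → ¬ AbelianVariety.IsIsogenous (A i) (A j))
    (hdim : ∀ i, (A i).dim ≤ 3 ∨ (((A i).dim).Prime ∧ 5 ≤ (A i).dim))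
    (hdist : ∀ a a', 5 ≤ (A a).dim → 5 ≤ (A a').dim → a ≠ a' → (A a).dim ≠ (A a').dim)
    (hP : ∀ a j, 5 ≤ (A a).dim → a ≠ j →
      ¬ ∃ F : IntermediateField ℚ (K a), finrank ℚ F = 2 ∧ IsTotallyComplex F ∧ Nonempty (F →+* K j))
    (h1 : ∀ i j : {b // ¬ 5 ≤ (A b).dim}, i ≠ j →
      ¬ ∃ F : IntermediateField ℚ (K i.1), finrank ℚ F = 2 ∧ IsTotallyComplex F ∧ Nonempty (F →+* K j.1))
    (h2 : ∀ i : {b // ¬ 5 ≤ (A b).dim}, finrank ℚ (K i.1) = 6 →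
      (Finset.univ.filter fun j : {b // ¬ 5 ≤ (A b).dim} => Nonempty (K j.1 ≃+* K i.1)).card ≤ 3)
    (h3 : ∀ i : {b // ¬ 5 ≤ (A b).dim}, finrank ℚ (K i.1) = 4 →
      (Finset.univ.filter fun j : {b // ¬ 5 ≤ (A b).dim} =>
        normalClosure ℚ (K j.1) ℂ = normalClosure ℚ (K i.1) ℂ).card ≤ 2)
    {N : ℕ} (π : Fin N → I) :
    HodgeConjectureFor (⨁ fun j : Fin N => A (π j)).dim (⨁ fun j : Fin N => A (π j)).X ∧
      ∀ m : ℕ, hodgeClassSpan (⨁ fun j : Fin N => A (π j)).dim (⨁ fun j : Fin N => A (π j)).X m =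
        divisorClassesSpan (⨁ fun j : Fin N => A (π j)).X (⨁ fun j : Fin N => A (π j)).dim m := by
  have h := (isNondegenerateFamily_iff_of_primeFactors_dim_le_three hA hS hniso hdim hdist).2 ⟨hP, h1, h2, h3⟩
  exact ⟨h.hodgeConjectureFor_prod hA π, fun m => h.hodgeClassSpan_prod_eq_divisorClassesSpan hA π m⟩

omit [DecidableEq I] in
/-- **A prime-dimensional factor sharing an imaginary quadratic field forces an exceptional Hodge class** on some product
of powers (simple, pairwise non-isogenous factors; any dimensions for the others). [cite: Gordon1999HodgeAVSurvey, 7.5–7.7 and 9.4] -/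
theorem exists_exceptional_prod_of_shared_quadratic_primeFactor
    (hA : ∀ i, IsCMTypeRealisation (Φ i) (A i) (ι i) (θ i)) (hS : ∀ i, (A i).IsSimple)
    (hniso : ∀ i j, i ≠ j → ¬ AbelianVariety.IsIsogenous (A i) (A j)) {a j : I} (haj : a ≠ j)
    (hF : ∃ F : IntermediateField ℚ (K a), finrank ℚ F = 2 ∧ IsTotallyComplex F ∧ Nonempty (F →+* K j)) :
    ∃ (N : ℕ) (π : Fin N → I) (m : ℕ) (c : complexBetti (⨁ fun j : Fin N => A (π j)).X (2 * m)),
      IsRationalClass c ∧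
      IsOfHodgeType (⨁ fun j : Fin N => A (π j)).dim (⨁ fun j : Fin N => A (π j)).X (2 * m) m m c ∧
      c ∉ divisorClassesSpan (⨁ fun j : Fin N => A (π j)).X (⨁ fun j : Fin N => A (π j)).dim m := by
  obtain ⟨F, hF2, hFtc, ⟨f⟩⟩ := hF
  haveI := hFtc
  exact CMAlgebra.exists_exceptional_prod_of_not_isNondegenerateFamily
    (CMAlgebra.isSeparatingFamily_of_isSimple_of_pairwise_not_isIsogenous hA hS hniso)
    (not_isNondegenerateFamily_of_shared_imaginary_quadratic (k := ↥F) hF2 haj (algebraMap (↥F) (K a)) f Φ) hA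

end Geometry

end Summit.HodgeConjecture.CorCM

end
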